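import Mathlib
import HarnessLib
import Summits.ValiantsHypothesis.ValiantsHypothesis.Theorems.SymmetryDialAffinePebble
import Summits.ValiantsHypothesis.ValiantsHypothesis.Theorems.SymmetryDialAffinePebbleTwo

/-!
# SymmetryDial — rung `k′ = 2` of `P′`: the permanent gap and the rung theorem

Sequel of `Theorems/SymmetryDialAffinePebbleTwo.lean` (Duplicator's two-pebble strategy
`affinePebbleEquiv_two_fg` between `𝔄(I + P_σ)` and `𝔄(I + P_τ)`).  Here:

* `coverSet σ = {π : π i ∈ {i, σ i} ∀ i}` is the `0/1`-permanent count of `I + P_σ`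
  (`filter_fg_eq_coverSet` + `SymmetryDialAffinePebble.eval_perPoly_eq_card`); for a fixed-point-free
  single cycle `σ` it lies inside `{1, σ}` (agreement with `σ` propagates along the orbit:
  `propagate`, `card_coverSet_le_two`), and three distinct members give `≥ 3`
  (`three_le_card_coverSet`);
* the witnesses on `𝔽₂³ ≃ Fin 8` (`e3`): `σ3` = the `8`-cycle, `τ3` = two disjoint `4`-cycles
  (fixed-point-free, no `2`-cycles, `σ3` transitive — all by `decide` on `Fin 8` and transport);
* **`affinePebblePairs_rung_two`**: `∃ d A B, AffinePebbleEquiv 2 d A B ∧ per A ≠ per B`, and the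
  packaged `affinePebblePairs_rungs_le_two` (monotonicity in `k′`).

Calibration value only; see the header of the prequel.
-/

set_option linter.dupNamespace false

namespace Summit.ValiantsHypothesis.ValiantsHypothesis.Theorems.SymmetryDialAffinePebbleTwoRung

open Finset
open Literature.Computability.AlgebraicComplexity
open Literature.ModelTheory.FiniteModelTheory
open SymmetryDialAffinePebble (V AffinePebbleEquiv AffinePebblePairs eval_perPoly_eq_card)
open SymmetryDialAffinePebbleTwo (fg fg_true affinePebbleEquiv_two_fg)

variable {d : ℕ}

/-! ### 3. Counting the permutations inside `I + P_σ` -/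

section Count

variable {α : Type*} [Fintype α] [DecidableEq α]

/-- The permutations inside `I + P_σ` (the cycle covers of the functional digraph with loops). -/
def coverSet (σ : Equiv.Perm α) : Finset (Equiv.Perm α) :=
  univ.filter fun π : Equiv.Perm α => ∀ x, π x = x ∨ π x = σ x

omit [Fintype α] [DecidableEq α] in
/-- Agreement with a fixed-point-free `σ` propagates forward along the `σ`-orbit. -/
theorem propagate (σ π : Equiv.Perm α) (hσ : ∀ x, σ x ≠ x) (hπ : ∀ x, π x = x ∨ π x = σ x)
    {x : α} (hx : π x = σ x) (k : ℕ) : π ((σ ^ k) x) = (σ ^ (k + 1)) x := by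
  induction k with
  | zero => simpa using hx
  | succ k ih =>
    rcases hπ ((σ ^ (k + 1)) x) with h | h
    · exfalso
      have e : (σ ^ (k + 1)) x = (σ ^ k) x := π.injective (h.trans ih.symm)
      rw [pow_succ', Equiv.Perm.mul_apply] at e
      exact hσ _ e
    · rw [h, pow_succ' σ (k + 1), Equiv.Perm.mul_apply]

/-- On a single `σ`-orbit the cover set is contained in `{1, σ}`. -/
theorem coverSet_subset_pair (σ : Equiv.Perm α) (hσ : ∀ x, σ x ≠ x)
    (htrans : ∀ x y : α, ∃ k : ℕ, (σ ^ k) x = y) : coverSet σ ⊆ {1, σ} := by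
  intro π hπ
  rw [coverSet, mem_filter] at hπ
  obtain ⟨-, hπ⟩ := hπ
  rw [mem_insert, mem_singleton]
  by_cases h1 : π = 1
  · exact Or.inl h1
  · right
    have hex : ∃ x, π x ≠ x := by
      by_contra hall
      push Not at hall
      exact h1 (Equiv.ext fun z => by simpa using hall z)
    obtain ⟨x, hx⟩ := hex
    have hxσ : π x = σ x := (hπ x).resolve_left hx
    ext z
    obtain ⟨k, rfl⟩ := htrans x z
    rw [propagate σ π hσ hπ hxσ k, pow_succ', Equiv.Perm.mul_apply]

/-- Hence at most two permutations lie inside `I + P_σ` when `σ` is a single cycle without fixed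
points. -/
theorem card_coverSet_le_two (σ : Equiv.Perm α) (hσ : ∀ x, σ x ≠ x)
    (htrans : ∀ x y : α, ∃ k : ℕ, (σ ^ k) x = y) : (coverSet σ).card ≤ 2 :=
  (card_le_card (coverSet_subset_pair σ hσ htrans)).trans Finset.card_le_two

/-- Three distinct permutations inside `I + P_τ` give `3 ≤ #coverSet τ`. -/
theorem three_le_card_coverSet (τ π₁ π₂ : Equiv.Perm α) (h₁ : ∀ x, π₁ x = x ∨ π₁ x = τ x)
    (h₂ : ∀ x, π₂ x = x ∨ π₂ x = τ x) (n1 : (1 : Equiv.Perm α) ≠ π₁) (n2 : (1 : Equiv.Perm α) ≠ π₂)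
    (n12 : π₁ ≠ π₂) : 3 ≤ (coverSet τ).card := by
  have hsub : ({1, π₁, π₂} : Finset (Equiv.Perm α)) ⊆ coverSet τ := by
    intro π hπ
    simp only [mem_insert, mem_singleton] at hπ
    rw [coverSet, mem_filter]
    refine ⟨mem_univ _, ?_⟩
    rcases hπ with rfl | rfl | rfl
    · exact fun x => Or.inl rfl
    · exact h₁
    · exact h₂
  calc 3 = ({1, π₁, π₂} : Finset (Equiv.Perm α)).card :=
        (card_eq_three.2 ⟨1, π₁, π₂, n1, n2, n12, rfl⟩).symm
    _ ≤ (coverSet τ).card := card_le_card hsub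

/-- The cover set is the permanent count of `eval_perPoly_eq_card` for the matrix `fg σ`. -/
theorem filter_fg_eq_coverSet (σ : Equiv.Perm (V d)) :
    (univ.filter fun π : Equiv.Perm (V d) => ∀ i, fg σ (π i, i) = true) = coverSet σ := by
  unfold coverSet
  refine filter_congr fun π _ => ?_
  simp only [fg_true]

end Count

/-! ### 4. The witnesses on `𝔽₂³`: an `8`-cycle against two `4`-cycles -/

section Witness

/-- Binary expansion `𝔽₂³ ≃ Fin 8`. -/
def e3 : V 3 ≃ Fin 8 := finFunctionFinEquiv.trans (finCongr (by norm_num))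

/-- The `8`-cycle `m ↦ m + 1` on `Fin 8`. -/
def σ8 : Equiv.Perm (Fin 8) :=
  ⟨![1, 2, 3, 4, 5, 6, 7, 0], ![7, 0, 1, 2, 3, 4, 5, 6], by intro m; fin_cases m <;> rfl,
    by intro m; fin_cases m <;> rfl⟩

/-- Two disjoint `4`-cycles `(0 1 2 3)(4 5 6 7)` on `Fin 8`. -/
def τ8 : Equiv.Perm (Fin 8) :=
  ⟨![1, 2, 3, 0, 5, 6, 7, 4], ![3, 0, 1, 2, 7, 4, 5, 6], by intro m; fin_cases m <;> rfl,
    by intro m; fin_cases m <;> rfl⟩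

/-- The single `4`-cycle `(0 1 2 3)` — a third permutation inside `I + P_τ`. -/
def τ8a : Equiv.Perm (Fin 8) :=
  ⟨![1, 2, 3, 0, 4, 5, 6, 7], ![3, 0, 1, 2, 4, 5, 6, 7], by intro m; fin_cases m <;> rfl,
    by intro m; fin_cases m <;> rfl⟩

/-- `σ8` has no fixed point. -/
theorem σ8_ne (m : Fin 8) : σ8 m ≠ m := by fin_cases m <;> decide
/-- `σ8` has no `2`-cycle. -/
theorem σ8_sq_ne (m : Fin 8) : σ8 (σ8 m) ≠ m := by fin_cases m <;> decide
/-- `τ8` has no fixed point. -/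
theorem τ8_ne (m : Fin 8) : τ8 m ≠ m := by fin_cases m <;> decide
/-- `τ8` has no `2`-cycle. -/
theorem τ8_sq_ne (m : Fin 8) : τ8 (τ8 m) ≠ m := by fin_cases m <;> decide
/-- `τ8a` lies inside `I + P_{τ8}`. -/
theorem τ8a_mem (m : Fin 8) : τ8a m = m ∨ τ8a m = τ8 m := by fin_cases m <;> decide
/-- `σ8` is transitive. -/
theorem σ8_trans (m m' : Fin 8) : ∃ k : Fin 8, (σ8 ^ (k : ℕ)) m = m' := by
  revert m m'; decide

/-- Transport of a permutation of `Fin 8` to `𝔽₂³`. -/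
def lift (ρ : Equiv.Perm (Fin 8)) : Equiv.Perm (V 3) := (e3.trans ρ).trans e3.symm

/-- Pointwise formula for `lift`. -/
theorem lift_apply (ρ : Equiv.Perm (Fin 8)) (x : V 3) : lift ρ x = e3.symm (ρ (e3 x)) := rfl

/-- `lift` is injective. -/
theorem lift_injective : Function.Injective lift := by
  intro ρ ρ' h
  refine Equiv.ext fun m => ?_
  have := congrArg (fun π : Equiv.Perm (V 3) => e3 (π (e3.symm m))) h
  simpa [lift_apply] using this

/-- `lift 1 = 1`. -/
theorem lift_one : lift 1 = 1 := by
  ext x; simp [lift_apply]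

/-- `lift` commutes with powers (pointwise). -/
theorem lift_pow (ρ : Equiv.Perm (Fin 8)) (k : ℕ) (x : V 3) : (lift ρ ^ k) x = e3.symm ((ρ ^ k) (e3 x)) := by
  induction k generalizing x with
  | zero => simp
  | succ k ih => rw [pow_succ, Equiv.Perm.mul_apply, lift_apply, ih, Equiv.apply_symm_apply,
      pow_succ, Equiv.Perm.mul_apply]

/-- `σ :=` the `8`-cycle on `𝔽₂³`. -/
def σ3 : Equiv.Perm (V 3) := lift σ8
/-- `τ :=` the two `4`-cycles on `𝔽₂³`. -/
def τ3 : Equiv.Perm (V 3) := lift τ8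

/-- `σ3` has no fixed point. -/
theorem σ3_ne (x : V 3) : σ3 x ≠ x := by
  intro h
  have := congrArg e3 h
  rw [σ3, lift_apply, Equiv.apply_symm_apply] at this
  exact σ8_ne _ this

/-- `σ3` has no `2`-cycle. -/
theorem σ3_sq_ne (x : V 3) : σ3 (σ3 x) ≠ x := by
  intro h
  have := congrArg e3 h
  rw [σ3, lift_apply, lift_apply, Equiv.apply_symm_apply, Equiv.apply_symm_apply] at this
  exact σ8_sq_ne _ this

/-- `τ3` has no fixed point. -/
theorem τ3_ne (x : V 3) : τ3 x ≠ x := by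
  intro h
  have := congrArg e3 h
  rw [τ3, lift_apply, Equiv.apply_symm_apply] at this
  exact τ8_ne _ this

/-- `τ3` has no `2`-cycle. -/
theorem τ3_sq_ne (x : V 3) : τ3 (τ3 x) ≠ x := by
  intro h
  have := congrArg e3 h
  rw [τ3, lift_apply, lift_apply, Equiv.apply_symm_apply, Equiv.apply_symm_apply] at this
  exact τ8_sq_ne _ this

/-- `σ3` is transitive. -/
theorem σ3_trans (x y : V 3) : ∃ k : ℕ, (σ3 ^ k) x = y := by
  obtain ⟨k, hk⟩ := σ8_trans (e3 x) (e3 y)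
  refine ⟨k, ?_⟩
  rw [σ3, lift_pow, hk, Equiv.symm_apply_apply]

/-- `per (I + P_σ) ≤ 2` on `𝔽₂³`. -/
theorem card_coverSet_σ3 : (coverSet σ3).card ≤ 2 := card_coverSet_le_two σ3 σ3_ne σ3_trans

/-- `per (I + P_τ) ≥ 3` on `𝔽₂³`. -/
theorem card_coverSet_τ3 : 3 ≤ (coverSet τ3).card := by
  refine three_le_card_coverSet τ3 (lift τ8a) (lift τ8) (fun x => ?_) (fun x => Or.inr rfl) ?_ ?_ ?_
  · rcases τ8a_mem (e3 x) with h | h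
    · left; rw [lift_apply, h, Equiv.symm_apply_apply]
    · right; rw [lift_apply, h]; rfl
  · rw [← lift_one]; exact fun h => absurd (lift_injective h) (by decide)
  · rw [← lift_one]; exact fun h => absurd (lift_injective h) (by decide)
  · exact fun h => absurd (lift_injective h) (by decide)

end Witness

/-! ### 5. Rung `k′ = 2` -/

/-- **Rung R₂ of P′** (`k′ = 2`, `d = 3`): the affine matrix structures of `I + P_σ` (`σ` an
`8`-cycle of `𝔽₂³`) and `I + P_τ` (`τ` two `4`-cycles) are `2`-pebble bijectively equivalent, and
their `0/1`-permanents differ (`≤ 2` versus `≥ 3`; in fact `2` and `4`). -/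
theorem affinePebblePairs_rung_two :
    ∃ (d : ℕ) (A B : V d × V d → Bool), AffinePebbleEquiv 2 d A B ∧
      MvPolynomial.eval (fun ij => if A ij = true then (1 : ℂ) else 0) (perPoly (V d) ℂ) ≠
        MvPolynomial.eval (fun ij => if B ij = true then (1 : ℂ) else 0) (perPoly (V d) ℂ) := by
  refine ⟨3, fg σ3, fg τ3, affinePebbleEquiv_two_fg σ3_ne σ3_sq_ne τ3_ne τ3_sq_ne, ?_⟩
  rw [eval_perPoly_eq_card, eval_perPoly_eq_card, filter_fg_eq_coverSet, filter_fg_eq_coverSet, Ne,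
    Nat.cast_inj]
  exact (lt_of_le_of_lt card_coverSet_σ3 (lt_of_lt_of_le (by norm_num) card_coverSet_τ3)).ne

/-- The rungs `k′ ≤ 2` of `AffinePebblePairs` in one statement. -/
theorem affinePebblePairs_rungs_le_two (k' : ℕ) (hk : k' ≤ 2) :
    ∃ (d : ℕ) (A B : V d × V d → Bool), AffinePebbleEquiv k' d A B ∧
      MvPolynomial.eval (fun ij => if A ij = true then (1 : ℂ) else 0) (perPoly (V d) ℂ) ≠
        MvPolynomial.eval (fun ij => if B ij = true then (1 : ℂ) else 0) (perPoly (V d) ℂ) := by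
  obtain ⟨d, A, B, hAB, hper⟩ := affinePebblePairs_rung_two
  exact ⟨d, A, B, SymmetryDialAffinePebble.affinePebbleEquiv_mono hk hAB, hper⟩


end Summit.ValiantsHypothesis.ValiantsHypothesis.Theorems.SymmetryDialAffinePebbleTwoRung
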